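import Summits.HodgeConjecture.HodgeConjecture.Theses.RigidRelativesJacobianTorelli
import Summits.HodgeConjecture.HodgeConjecture.Theorems.MotivatedLefschetzSplitLefschetzStandardBCharlesSpread
import Literature.AlgebraicGeometry.HodgeTheory.HodgeTypeVanishing
import Literature.AlgebraicGeometry.Motives.BaseChangeProofs
import HarnessLib

/-!
# Crux `RelativesTate` (stmt-HodgeConjecture-18578), line `birth` — stub 2 `stub_algebraicLeftInverse`:
# AN INJECTIVE ALGEBRAIC CORRESPONDENCE OUT OF A RIGID-TYPE `Hⁿ` HAS AN ALGEBRAIC LEFT INVERSE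

Route `HodgeConjecture/RigidRelativesJacobianTorelli`, crux `RelativesTate` (rank 2, "Galois ≤ algebraic", iso face);
registered skeleton `Cruxes/RelativesTate/Lines/birth.lean` (`RelativesTate_of : Sig.stub_kugaSatoAnchor →
Sig.stub_algebraicLeftInverse → Sig.stub_kugaSatoTransit → Sig.stub_algebraicComp → RelativesTate`). The same statement,
with the rationality clause of `IsAnchor` added, is stub 3 `stub_algebraicLeftInverse` of the sibling crux
`CMCorrespondenceTate` (stmt-HodgeConjecture-18580), and it is the route `RigidUnwinding`'s informal support
`AlgebraicInverse` (stmt-HodgeConjecture-13657) in left-inverse form ("Lieberman's trick").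

**Theorem** (`exists_algebraicLeftInverse`, on the tree's real carriers, for every `n ≥ 1`). Let `X`, `Y` be smooth
projective complex varieties of dimension `n` such that `Hⁿ(X(ℂ); ℂ) = H^{n,0} ⊕ H^{0,n}` (every class is a sum of a
class of type `(n,0)` and a class of type `(0,n)` — e.g. `dim Hⁿ = 2` with a non-zero `(n,0)`-class: RIGID TYPE,
`exists_algebraicLeftInverse_of_finrank_eq_two`), and let `A : Hⁿ(X(ℂ); ℂ) → Hⁿ(Y(ℂ); ℂ)` be INJECTIVE and induced by
an algebraic class on `Y × X` (`IsAlgebraicCorrespondence n n Y X A`; complex combinations of cycle classes allowed).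
Then there is `B : Hⁿ(Y(ℂ); ℂ) → Hⁿ(X(ℂ); ℂ)` induced by an algebraic class on `X × Y` with `B ∘ A = id`.

Proof. Normalise `A = [γ]_*`, `γ ∈ Nᵉ H^{2e}((Y ⊗ X)(ℂ))` for the complex orientations (part XXII-e of the AbelianAll
André axis). Put `G := [conj γ]^t : Hⁿ(Y) → Hⁿ(X)`, the TRANSPOSE of the CONJUGATE class (algebraic: `conj γ` is
algebraic, `conjClass_mem_algebraicClasses`, and transposes are algebraic, `isAlgebraicCorrespondence_transposeAction`;
the bare transpose `[γ]^t` would not do for complex `γ` — `[γ]^t ∘ [γ]_*` can vanish on `Q`-isotropic planes, cf. the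
refuter's note on stmt-13657). `E := G ∘ A ∈ End Hⁿ(X)` is algebraic (`IsAlgebraicCorrespondence.comp`) and INJECTIVE:
if `G (A x) = 0` then by the trace-free duality `([δ]_* u) ∪ w = 0 ↔ u ∪ ([δ]^t w) = 0` (part III of the
`LefschetzStandardB` files, `cup_corrAction_eq_zero_iff`) and `[conj γ]_* (conj v) = conj ([γ]_* v)`
(`conjClass_corrAction`), `conj(A v) ∪ A x = 0` for every `v`. Write `x = x₁ + x₂` with `x₁ ∈ H^{n,0}`, `x₂ ∈ H^{0,n}`;
`A` preserves Hodge types (`γ` has type `(e,e)`, `e = n`), so `y₁ = A x₁ ∈ H^{n,0}(Y)`, `y₂ = A x₂ ∈ H^{0,n}(Y)`. Testing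
`v = x₁`: `conj y₁ ∪ y₁ + conj y₁ ∪ y₂ = 0`, and the second term has type `(0, 2n)`, zero on the `n`-fold `Y`; so
`y₁ ∪ conj y₁ = 0`, whence `y₁ = 0` by the SECOND HODGE–RIEMANN RELATION for the (automatically primitive) class `y₁`
(`KaehlerRationalDatum.hodgeRiemann_X`: `iⁿ (−1)^{n(n−1)/2} y₁ ∪ conj y₁ = t · Ω`, `t > 0`). Likewise `y₂ = 0`; so
`A x = 0` and `x = 0`. Hence `E` is invertible and, by Cayley–Hamilton (`exists_sum_smul_pow_comp_eq_id`),
`(Σ c_k Eᵏ) ∘ E = id`; `B := (Σ c_k Eᵏ) ∘ G` is algebraic (`isAlgebraicCorrespondence_sum_smul_pow_comp`) and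
`B ∘ A = (Σ c_k Eᵏ) ∘ E = id`.

§5 gives the stub in the skeleton's spelling (`algebraicLeftInverse`: the body of `Sig.stub_algebraicLeftInverse` with
the skeleton-local carriers `Rigid`, `cx` unfolded — the `Lines/` module is not importable), for `X = X₀ ⊗_ℚ ℂ`.

Nothing here is a case of the Hodge or Tate conjectures; no definition, no named fact, no sorry.
References: [Kleiman1968AlgebraicCycles] §1.3, §3 Prop. 3.5, Appendix to §2 (Thm. 2A11); [Lieberman1968] Thm. 1;
[VoisinHodgeI2002] §6.3.2 Thm. 6.32, Cor. 6.12, §7.1.2, §7.3.2; [Fulton1998] §16.1; [Andre1996Motifs] §2.1 (p. 14);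
[Deligne1982HodgeCycles] §1–2.
-/

noncomputable section

-- every declaration of this problem lives in `Summit.HodgeConjecture.HodgeConjecture.…` (summit = sub-problem)
set_option linter.dupNamespace false

open CategoryTheory AlgebraicGeometry MonoidalCategory CartesianMonoidalCategory
open Literature.AlgebraicGeometry.Motives Literature.AlgebraicGeometry.HodgeTheory
open Literature.AlgebraicTopology.SingularHomology (singularCohomology cupProduct cupProduct_gradedComm_holds)
open Literature.Geometry.Kaehler (lefschetzPow lefschetzPow_zero)
open Summit.HodgeConjecture.HodgeConjecture.Ring2.AbelianAll

namespace Summit.HodgeConjecture.HodgeConjecture.Theorems.RelativesTate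

variable {m n : ℕ} {X Y : SchemeOver ℂ}

/-! ## §1 Second Hodge–Riemann relation for classes of type `(n,0)` and `(0,n)` -/

/-- **`ξ ∪ conj ξ ≠ 0` for a non-zero class `ξ ∈ Hⁿ(Y(ℂ); ℂ)` of type `(n, 0)` on a smooth projective `n`-fold `Y`.**
`ξ` is primitive (`L ξ` has type `(n+1, 1)`, zero on an `n`-fold), so Hodge–Riemann (Voisin I Thm. 6.32, the tree's
`KaehlerRationalDatum.hodgeRiemann_X` for a Kähler–rational datum of `Y`) gives `iⁿ(−1)^{n(n−1)/2} ξ ∪ conj ξ = t Ω` with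
`t > 0` and `Ω ≠ 0` the top Kähler class. [cite: VoisinHodgeI2002, §6.3.2 Thm. 6.32 and Rem. 6.27] -/
theorem cup_conjClass_ne_zero_of_isOfHodgeType_n_zero (hY : IsSmoothProjective n Y) (h : n + n = 2 * n)
    {ξ : complexBetti Y n} (hξ : IsOfHodgeType n Y n n 0 ξ) (hξ0 : ξ ≠ 0) :
    cupProduct h ξ (conjClass (ComplexPoints Y) n ξ) ≠ 0 := by
  obtain ⟨D⟩ := nonempty_kaehlerRationalDatum hY
  -- `L ξ` is of type `(n + 1, 1)`, hence zero: `ξ` is primitive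
  have hup := isOfHodgeType_lefschetzOperator_of_cupPreservesHodgeType
    (cupPreservesHodgeType_of_hodgeModel hY D.B) D.isOfHodgeType_Hη
  have hL : IsOfHodgeType n Y (n + 2 * 1) (n + 1) (0 + 1) (lefschetzPow D.Hη 1 n ξ) :=
    isOfHodgeType_lefschetzPow_of_lefschetzOperator hup 1 n n 0 ξ hξ
  have hprim : lefschetzPow D.Hη (0 + 1) n ξ = 0 := hL.eq_zero_of_lt hY (Or.inl (by omega))
  obtain ⟨t, ht, heq⟩ := D.hodgeRiemann_X hY (a := n) (s := n) (t' := 0) (r₀ := 0) (by omega) (by omega)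
    hξ hξ0 hprim
  have hrhs : (t : ℂ) • D.topClass ≠ 0 := smul_ne_zero (by exact_mod_cast ht.ne') (D.topClass_ne_zero hY)
  rw [← heq] at hrhs
  have hx := (smul_ne_zero_iff.1 hrhs).2
  simpa only [lefschetzPow_zero, LinearMap.id_apply] using hx

/-- **`conj y₁ ∪ (y₁ + y₂) = 0` forces `y₁ = 0`** for `y₁` of type `(n,0)` and `y₂` of type `(0,n)` on a smooth projective
`n`-fold, `n ≥ 1`: the cross term `conj y₁ ∪ y₂` has type `(0, 2n)` and vanishes, and `conj y₁ ∪ y₁ = ± y₁ ∪ conj y₁`.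
[cite: VoisinHodgeI2002, §6.3.2 Thm. 6.32 and Lemma 6.31] -/
theorem eq_zero_of_conj_cup_eq_zero_left (hY : IsSmoothProjective n Y) (hn : 0 < n) (h : n + n = 2 * n)
    {y₁ y₂ : complexBetti Y n} (hy₁ : IsOfHodgeType n Y n n 0 y₁) (hy₂ : IsOfHodgeType n Y n 0 n y₂)
    (h0 : cupProduct h (conjClass (ComplexPoints Y) n y₁) (y₁ + y₂) = 0) : y₁ = 0 := by
  obtain ⟨C⟩ := (nonempty_hodgeModel_holds (n := n) (X := Y)).nonempty hY
  have hcup := cupPreservesHodgeType_of_hodgeModel hY C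
  have hc₁ : IsOfHodgeType n Y n 0 n (conjClass (ComplexPoints Y) n y₁) := hy₁.conjClass hY
  -- the cross term vanishes
  have hcross : cupProduct h (conjClass (ComplexPoints Y) n y₁) y₂ = 0 :=
    (hcup h hc₁ hy₂).eq_zero_of_lt hY (Or.inr (by omega))
  rw [map_add, hcross, add_zero] at h0
  -- graded commutativity
  have hcomm := cupProduct_gradedComm_holds ℂ (ComplexPoints Y) h h (conjClass (ComplexPoints Y) n y₁) y₁
  rw [h0] at hcomm
  have h0' : cupProduct h y₁ (conjClass (ComplexPoints Y) n y₁) = 0 := by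
    have hu : ((-1 : ℂ) ^ (n * n)) ≠ 0 := pow_ne_zero _ (neg_ne_zero.2 one_ne_zero)
    exact (smul_eq_zero_iff_right hu).1 hcomm.symm
  by_contra hne
  exact cup_conjClass_ne_zero_of_isOfHodgeType_n_zero hY h hy₁ hne h0'

/-- **`conj y₂ ∪ (y₁ + y₂) = 0` forces `y₂ = 0`** (the mirror statement: apply the previous lemma's mechanism to
`z = conj y₂`, of type `(n,0)`, with `conj z = y₂`). [cite: VoisinHodgeI2002, §6.3.2 Thm. 6.32 and Cor. 6.12] -/
theorem eq_zero_of_conj_cup_eq_zero_right (hY : IsSmoothProjective n Y) (hn : 0 < n) (h : n + n = 2 * n)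
    {y₁ y₂ : complexBetti Y n} (hy₁ : IsOfHodgeType n Y n n 0 y₁) (hy₂ : IsOfHodgeType n Y n 0 n y₂)
    (h0 : cupProduct h (conjClass (ComplexPoints Y) n y₂) (y₁ + y₂) = 0) : y₂ = 0 := by
  obtain ⟨C⟩ := (nonempty_hodgeModel_holds (n := n) (X := Y)).nonempty hY
  have hcup := cupPreservesHodgeType_of_hodgeModel hY C
  have hc₂ : IsOfHodgeType n Y n n 0 (conjClass (ComplexPoints Y) n y₂) := hy₂.conjClass hY
  -- the cross term vanishes
  have hcross : cupProduct h (conjClass (ComplexPoints Y) n y₂) y₁ = 0 :=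
    (hcup h hc₂ hy₁).eq_zero_of_lt hY (Or.inl (by omega))
  rw [map_add, hcross, zero_add] at h0
  -- `z = conj y₂` is a `(n,0)`-class with `z ∪ conj z = 0`
  have hz : cupProduct h (conjClass (ComplexPoints Y) n y₂)
      (conjClass (ComplexPoints Y) n (conjClass (ComplexPoints Y) n y₂)) = 0 := by
    rwa [conjClass_conjClass]
  by_contra hne
  exact cup_conjClass_ne_zero_of_isOfHodgeType_n_zero hY h hc₂ (conjClass_ne_zero hne) hz

/-! ## §2 Hodge types along a correspondence (complex orientations) -/

/-- **`[γ]_*` has bidegree `(e − dim X, e − dim X)` on Hodge types for `γ` of type `(e, e)`** (pull-back preserves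
types, `∪ γ` adds `(e, e)`, `pr_{Y*}` shifts by `−dim X`; Voisin I §7.3.2), for the complex orientation family.
[cite: VoisinHodgeI2002, §7.3.2 (with Lemma 7.30) and Lemma 11.41] -/
theorem isOfHodgeType_corrAction (hY : IsSmoothProjective m Y) (hX : IsSmoothProjective n X) {e a b : ℕ}
    (hab : a + 2 * e = b + 2 * n) {γ : complexBetti (Y ⊗ X) (2 * e)}
    (hγ : IsOfHodgeType (m + n) (Y ⊗ X) (2 * e) e e γ) {p q p' q' : ℕ} (hp : p' + n = p + e)
    (hq : q' + n = q + e) {x : complexBetti X a} (hx : IsOfHodgeType n X a p q x) :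
    IsOfHodgeType m Y b p' q' (corrAction complexOrientationFamily hY hX hab γ x) := by
  have hI := hodgePQ_independent_of_hodgeModel_holds
  have hYX := hY.tensor_holds hX
  obtain ⟨C⟩ := (nonempty_hodgeModel_holds (n := m + n) (X := Y ⊗ X)).nonempty hYX
  have h1 : IsOfHodgeType (m + n) (Y ⊗ X) a p q (complexBetti.map (snd Y X) a x) :=
    IsOfHodgeType.map_of_independent hI hx hYX hX C (snd Y X)
  have h2 : IsOfHodgeType (m + n) (Y ⊗ X) (a + 2 * e) (p + e) (q + e)
      (cupProduct rfl (complexBetti.map (snd Y X) a x) γ) :=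
    cupPreservesHodgeType_of_hodgeModel hYX C rfl h1 hγ
  rw [corrAction_apply]
  exact isOfHodgeType_complexGysin hI (fun _ _ ↦ nonempty_hodgeModel_holds)
    (fun E _ _ _ ↦ Literature.NumberTheory.Transcendental.exists_deRhamIsoFamily_holds E) complexOrientationFamily
    hYX hY (fst Y X) (corrAction_degree m hab) (by omega) (by omega) h2

/-! ## §3 Injectivity of `[conj γ]^t ∘ [γ]_*` on a rigid-type `Hⁿ` -/

/-- **`[conj γ]_* (conj v) = conj ([γ]_* v)`** (`conjClass_corrAction` and `conj conj = id`). [cite: VoisinHodgeI2002, Cor. 6.12 and §7.3.2] -/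
theorem corrAction_conjClass_conjClass (hY : IsSmoothProjective m Y) (hX : IsSmoothProjective n X) {e a b : ℕ}
    (hab : a + 2 * e = b + 2 * n) (γ : complexBetti (Y ⊗ X) (2 * e)) (v : complexBetti X a) :
    corrAction complexOrientationFamily hY hX hab (conjClass (ComplexPoints (Y ⊗ X)) (2 * e) γ)
        (conjClass (ComplexPoints X) a v) =
      conjClass (ComplexPoints Y) b (corrAction complexOrientationFamily hY hX hab γ v) := by
  rw [LefschetzStandardB.conjClass_corrAction hY hX hab γ v]

/-- **The vanishing produced by the transpose of the conjugate class.** For `γ ∈ H^{2e}((Y ⊗ X)(ℂ))`, `A = [γ]_*`,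
`G = [conj γ]^t` (all degrees `n`, `dim X = dim Y = n`): if `G (A x) = 0` then `conj (A v) ∪ A x = 0` for every `v`
(trace-free duality `cup_corrAction_eq_zero_iff` with `δ = conj γ`, `u = conj v`). [cite: Fulton1998, §16.1]
[cite: HatcherAT2002, §3.2 Thm. 3.11] -/
theorem conj_cup_eq_zero_of_transpose_conj_eq_zero (hY : IsSmoothProjective n Y) (hX : IsSmoothProjective n X) {e : ℕ}
    (h₁ : n + 2 * e = n + 2 * n) (h₂ : n + 2 * e + 2 * n = n + 2 * (n + n)) (h : n + n = 2 * n)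
    (γ : complexBetti (Y ⊗ X) (2 * e)) {x : complexBetti X n}
    (hx : complexGysin complexOrientationFamily (hY.tensor_holds hX) hX (snd Y X) h₂
      (cupProduct rfl (complexBetti.map (fst Y X) n (corrAction complexOrientationFamily hY hX h₁ γ x))
        (conjClass (ComplexPoints (Y ⊗ X)) (2 * e) γ)) = 0)
    (v : complexBetti X n) :
    cupProduct h (conjClass (ComplexPoints Y) n (corrAction complexOrientationFamily hY hX h₁ γ v))
      (corrAction complexOrientationFamily hY hX h₁ γ x) = 0 := by
  have hdual := (LefschetzStandardB.cup_corrAction_eq_zero_iff hY hX h₁ h h₂ h (conjClass (ComplexPoints (Y ⊗ X)) (2 * e) γ)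
    (conjClass (ComplexPoints X) n v) (corrAction complexOrientationFamily hY hX h₁ γ x)).2
    (by rw [hx, map_zero])
  rwa [corrAction_conjClass_conjClass hY hX h₁ γ v] at hdual

/-- **`[conj γ]^t ∘ [γ]_*` is injective on `Hⁿ(X) = H^{n,0} ⊕ H^{0,n}` when `[γ]_*` is** (`n ≥ 1`, `dim X = dim Y = n`,
`γ` of type `(e,e)`): for `x = x₁ + x₂` in the kernel, testing the vanishing `conj (A v) ∪ A x = 0` of the previous lemma
at `v = x₁` and `v = x₂` kills `A x₁ ∈ H^{n,0}(Y)` and `A x₂ ∈ H^{0,n}(Y)` by Hodge–Riemann (§1), so `A x = 0`.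
[cite: VoisinHodgeI2002, §6.3.2 Thm. 6.32] [cite: Kleiman1968AlgebraicCycles, §3 Prop. 3.5] -/
theorem transpose_conj_comp_injective (hY : IsSmoothProjective n Y) (hX : IsSmoothProjective n X) (hn : 0 < n)
    {e : ℕ} (h₁ : n + 2 * e = n + 2 * n) (h₂ : n + 2 * e + 2 * n = n + 2 * (n + n))
    {γ : complexBetti (Y ⊗ X) (2 * e)} (hγ : IsOfHodgeType (n + n) (Y ⊗ X) (2 * e) e e γ)
    (hspan : ∀ x : complexBetti X n, ∃ x₁ x₂ : complexBetti X n,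
      IsOfHodgeType n X n n 0 x₁ ∧ IsOfHodgeType n X n 0 n x₂ ∧ x = x₁ + x₂)
    (hinj : Function.Injective (corrAction complexOrientationFamily hY hX h₁ γ)) :
    Function.Injective
      (complexGysin complexOrientationFamily (hY.tensor_holds hX) hX (snd Y X) h₂ ∘ₗ
        (cupProduct (rfl : n + 2 * e = n + 2 * e)).flip (conjClass (ComplexPoints (Y ⊗ X)) (2 * e) γ) ∘ₗ
          (complexBetti.map (fst Y X) n).hom ∘ₗ corrAction complexOrientationFamily hY hX h₁ γ) := by
  have he : e = n := by omega
  subst he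
  have h : e + e = 2 * e := by omega
  set A := corrAction complexOrientationFamily hY hX h₁ γ with hA
  rw [injective_iff_map_eq_zero]
  intro x hx
  have hx' : complexGysin complexOrientationFamily (hY.tensor_holds hX) hX (snd Y X) h₂
      (cupProduct rfl (complexBetti.map (fst Y X) e (A x)) (conjClass (ComplexPoints (Y ⊗ X)) (2 * e) γ)) = 0 := by
    simpa only [LinearMap.comp_apply, LinearMap.flip_apply] using hx
  have hvan := conj_cup_eq_zero_of_transpose_conj_eq_zero hY hX h₁ h₂ h γ hx'
  obtain ⟨x₁, x₂, hx₁, hx₂, rfl⟩ := hspan x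
  -- Hodge types of `A x₁`, `A x₂`
  have hy₁ : IsOfHodgeType e Y e e 0 (A x₁) := isOfHodgeType_corrAction hY hX h₁ hγ (by omega) (by omega) hx₁
  have hy₂ : IsOfHodgeType e Y e 0 e (A x₂) := isOfHodgeType_corrAction hY hX h₁ hγ (by omega) (by omega) hx₂
  -- test at `v = x₁` and `v = x₂`
  have h1 := hvan x₁
  have h2 := hvan x₂
  rw [map_add] at h1 h2
  have hz₁ : A x₁ = 0 := eq_zero_of_conj_cup_eq_zero_left hY hn h hy₁ hy₂ h1
  have hz₂ : A x₂ = 0 := eq_zero_of_conj_cup_eq_zero_right hY hn h hy₁ hy₂ h2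
  have hx₁0 : x₁ = 0 := hinj (by rw [hz₁, map_zero])
  have hx₂0 : x₂ = 0 := hinj (by rw [hz₂, map_zero])
  rw [hx₁0, hx₂0, add_zero]

/-! ## §4 The algebraic left inverse -/

/-- **Powers of an algebraic endo-correspondence of `X` composed with an algebraic correspondence `Y ⊢ X` are algebraic**
(`uᵏ ∘ θ`, induction on `k`; `IsAlgebraicCorrespondence.comp`). [cite: Fulton1998, §16.1 Prop. 16.1.1]
[cite: Kleiman1968AlgebraicCycles, §1.3 and Appendix to §2, proof of Thm. 2A11] -/
theorem isAlgebraicCorrespondence_pow_comp (hX : IsSmoothProjective n X) (hY : IsSmoothProjective m Y) {a b : ℕ}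
    (hab : a ≤ b + 2 * m) {u : complexBetti X b →ₗ[ℂ] complexBetti X b} (hu : IsAlgebraicCorrespondence n n X X u)
    {θ : complexBetti Y a →ₗ[ℂ] complexBetti X b} (hθ : IsAlgebraicCorrespondence n m X Y θ) :
    ∀ k : ℕ, IsAlgebraicCorrespondence n m X Y ((u ^ k) ∘ₗ θ)
  | 0 => by rwa [pow_zero, Module.End.one_eq_id, LinearMap.id_comp]
  | k + 1 => by
    rw [pow_succ', Module.End.mul_eq_comp, LinearMap.comp_assoc]
    exact IsAlgebraicCorrespondence.comp hX hX hY (isAlgebraicCorrespondence_pow_comp hX hY hab hu hθ k) hu hab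

/-- **Polynomials in an algebraic endo-correspondence of `X`, composed with an algebraic correspondence `Y ⊢ X`, are
algebraic**: `(Σ_{k ∈ s} c_k uᵏ) ∘ θ` (`IsAlgebraicCorrespondence.sum`). [cite: Kleiman1968AlgebraicCycles, Appendix to §2, proof of Thm. 2A11]
[cite: Andre1996Motifs, §2.1 (p. 14)] -/
theorem isAlgebraicCorrespondence_sum_smul_pow_comp (hX : IsSmoothProjective n X) (hY : IsSmoothProjective m Y)
    {a b : ℕ} (hab : a ≤ b + 2 * m) {u : complexBetti X b →ₗ[ℂ] complexBetti X b}
    (hu : IsAlgebraicCorrespondence n n X X u) {θ : complexBetti Y a →ₗ[ℂ] complexBetti X b}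
    (hθ : IsAlgebraicCorrespondence n m X Y θ) (s : Finset ℕ) (c : ℕ → ℂ) :
    IsAlgebraicCorrespondence n m X Y ((∑ k ∈ s, c k • u ^ k) ∘ₗ θ) := by
  have heq : (∑ k ∈ s, c k • u ^ k) ∘ₗ θ = ∑ k ∈ s, c k • ((u ^ k) ∘ₗ θ) := by
    refine LinearMap.ext fun x ↦ ?_
    simp only [LinearMap.comp_apply, LinearMap.sum_apply, LinearMap.smul_apply]
  rw [heq]
  exact IsAlgebraicCorrespondence.sum hX hY s c (fun k ↦ (u ^ k) ∘ₗ θ)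
    (isAlgebraicCorrespondence_pow_comp hX hY hab hu hθ) 0

/-- **An injective algebraic correspondence `A : Hⁿ(X) → Hⁿ(Y)` out of `Hⁿ(X) = H^{n,0} ⊕ H^{0,n}` has an algebraic left
inverse** (`X`, `Y` smooth projective of dimension `n ≥ 1`): `B = (Σ c_k Eᵏ) ∘ [conj γ]^t` with `E = [conj γ]^t ∘ [γ]_*`
injective (§3) and `(Σ c_k Eᵏ) ∘ E = id` by Cayley–Hamilton. [cite: Kleiman1968AlgebraicCycles, Appendix to §2 (Thm. 2A11) and §3]
[cite: VoisinHodgeI2002, §6.3.2 Thm. 6.32] [cite: Lieberman1968, Thm. 1] -/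
theorem exists_algebraicLeftInverse (hX : IsSmoothProjective n X) (hY : IsSmoothProjective n Y) (hn : 0 < n)
    (hspan : ∀ x : complexBetti X n, ∃ x₁ x₂ : complexBetti X n,
      IsOfHodgeType n X n n 0 x₁ ∧ IsOfHodgeType n X n 0 n x₂ ∧ x = x₁ + x₂)
    {A : complexBetti X n →ₗ[ℂ] complexBetti Y n} (hA : IsAlgebraicCorrespondence n n Y X A)
    (hinj : Function.Injective A) :
    ∃ B : complexBetti Y n →ₗ[ℂ] complexBetti X n, IsAlgebraicCorrespondence n n X Y B ∧ B ∘ₗ A = LinearMap.id := by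
  -- normalise `A = [γ]_*` for the complex orientations
  obtain ⟨e, h₁, γ, hγ, rfl⟩ := IsAlgebraicCorrespondence.exists_eq_corrAction hY hX hA
  have hYX := hY.tensor_holds hX
  have hγT : IsOfHodgeType (n + n) (Y ⊗ X) (2 * e) e e γ :=
    isOfHodgeType_of_mem_algebraicClasses_of_isSmoothProjective hYX e hγ
  have h₂ : n + 2 * e + 2 * n = n + 2 * (n + n) := by omega
  -- `G = [conj γ]^t`, algebraic
  set G : complexBetti Y n →ₗ[ℂ] complexBetti X n :=
    complexGysin complexOrientationFamily hYX hX (snd Y X) h₂ ∘ₗ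
      (cupProduct (rfl : n + 2 * e = n + 2 * e)).flip (conjClass (ComplexPoints (Y ⊗ X)) (2 * e) γ) ∘ₗ
        (complexBetti.map (fst Y X) n).hom with hG
  have hGalg : IsAlgebraicCorrespondence n n X Y G :=
    LefschetzStandardB.isAlgebraicCorrespondence_transposeAction hY hX h₂ (by omega) (conjClass_mem_algebraicClasses hYX hγ)
  -- `E = G ∘ A`, algebraic and injective
  set E : complexBetti X n →ₗ[ℂ] complexBetti X n := G ∘ₗ corrAction complexOrientationFamily hY hX h₁ γ with hE
  have hEalg : IsAlgebraicCorrespondence n n X X E :=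
    IsAlgebraicCorrespondence.comp hX hY hX (isAlgebraicCorrespondence_corrAction_complex hY hX h₁ (by omega) hγ)
      hGalg (by omega)
  have hEinj : Function.Injective E := by
    have h := transpose_conj_comp_injective hY hX hn h₁ h₂ hγT hspan hinj
    simpa only [hE, hG, LinearMap.comp_assoc] using h
  -- Cayley–Hamilton
  haveI := finite_complexBetti_of_isSmoothProjective hX n
  obtain ⟨s, c, hinv⟩ := exists_sum_smul_pow_comp_eq_id E hEinj
  refine ⟨(∑ k ∈ s, c k • E ^ k) ∘ₗ G, ?_, ?_⟩
  · exact isAlgebraicCorrespondence_sum_smul_pow_comp hX hY (by omega) hEalg hGalg s c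
  · rw [LinearMap.comp_assoc]
    exact hinv

/-- **Rigid type gives the type decomposition**: if `dim Hⁿ(X(ℂ); ℂ) = 2` and `Hⁿ` contains a non-zero class `x₀` of type
`(n, 0)` (`n ≥ 1`), then every class is `a x₀ + b conj x₀`, a sum of an `(n,0)`- and a `(0,n)`-class (`x₀`, `conj x₀` are
independent: a class of two different types is zero). [cite: VoisinHodgeI2002, Cor. 6.12 and Cor. 6.14] -/
theorem exists_types_of_finrank_eq_two (hX : IsSmoothProjective n X) (hn : 0 < n)
    (hfin : Module.finrank ℂ (complexBetti X n) = 2) {x₀ : complexBetti X n} (hx₀0 : x₀ ≠ 0)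
    (hx₀ : IsOfHodgeType n X n n 0 x₀) (x : complexBetti X n) :
    ∃ x₁ x₂ : complexBetti X n, IsOfHodgeType n X n n 0 x₁ ∧ IsOfHodgeType n X n 0 n x₂ ∧ x = x₁ + x₂ := by
  have hc₀ : IsOfHodgeType n X n 0 n (conjClass (ComplexPoints X) n x₀) := hx₀.conjClass hX
  -- `x₀`, `conj x₀` are linearly independent
  have hli : LinearIndependent ℂ ![x₀, conjClass (ComplexPoints X) n x₀] := by
    refine LinearIndependent.pair_iff.2 fun a b hab ↦ ?_
    have ha : IsOfHodgeType n X n n 0 (a • x₀) := hx₀.smul a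
    have ha' : IsOfHodgeType n X n 0 n (a • x₀) := by
      have h : a • x₀ = -(b • conjClass (ComplexPoints X) n x₀) := eq_neg_of_add_eq_zero_left hab
      rw [h]
      exact (hc₀.smul b).neg
    have haz : a • x₀ = 0 := ha.eq_zero_of_ne hX ha' (by simp only [ne_eq, Prod.mk.injEq]; omega)
    have ha0 : a = 0 := by
      rcases smul_eq_zero.1 haz with h | h
      · exact h
      · exact absurd h hx₀0
    rw [ha0, zero_smul, zero_add] at hab
    have hb0 : b = 0 := by
      rcases smul_eq_zero.1 hab with h | h
      · exact h
      · exact absurd h (conjClass_ne_zero hx₀0)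
    exact ⟨ha0, hb0⟩
  haveI := finite_complexBetti_of_isSmoothProjective hX n
  have hspan : Submodule.span ℂ (Set.range ![x₀, conjClass (ComplexPoints X) n x₀]) = ⊤ :=
    hli.span_eq_top_of_card_eq_finrank (by rw [hfin]; simp)
  have hx : x ∈ Submodule.span ℂ (Set.range ![x₀, conjClass (ComplexPoints X) n x₀]) := by rw [hspan]; trivial
  rw [Submodule.mem_span_range_iff_exists_fun] at hx
  obtain ⟨c, rfl⟩ := hx
  refine ⟨c 0 • x₀, c 1 • conjClass (ComplexPoints X) n x₀, hx₀.smul _, hc₀.smul _, ?_⟩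
  simp [Fin.sum_univ_two]

/-- **Rigid-type form.** For `X`, `Y` smooth projective of dimension `n ≥ 1` with `dim Hⁿ(X(ℂ); ℂ) = 2` and a non-zero
`(n,0)`-class on `X`, every injective algebraic correspondence `Hⁿ(X) → Hⁿ(Y)` has an algebraic left inverse.
[cite: Kleiman1968AlgebraicCycles, Appendix to §2 (Thm. 2A11) and §3] [cite: VoisinHodgeI2002, §6.3.2 Thm. 6.32] -/
theorem exists_algebraicLeftInverse_of_finrank_eq_two (hX : IsSmoothProjective n X) (hY : IsSmoothProjective n Y)
    (hn : 0 < n) (hfin : Module.finrank ℂ (complexBetti X n) = 2)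
    (hx₀ : ∃ x : complexBetti X n, x ≠ 0 ∧ IsOfHodgeType n X n n 0 x)
    {A : complexBetti X n →ₗ[ℂ] complexBetti Y n} (hA : IsAlgebraicCorrespondence n n Y X A)
    (hinj : Function.Injective A) :
    ∃ B : complexBetti Y n →ₗ[ℂ] complexBetti X n, IsAlgebraicCorrespondence n n X Y B ∧ B ∘ₗ A = LinearMap.id := by
  obtain ⟨x₀, hx₀0, hx₀T⟩ := hx₀
  exact exists_algebraicLeftInverse hX hY hn (exists_types_of_finrank_eq_two hX hn hfin hx₀0 hx₀T) hA hinj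

/-! ## §5 The stub, in the skeleton's spelling -/

/-- **Stub `stub_algebraicLeftInverse` of crux `RelativesTate` — the body of `Sig.stub_algebraicLeftInverse` with the
skeleton's carriers `cx X₀ = (baseChange ℚ ℂ).obj X₀` and `Rigid X₀` unfolded**: for a RIGID-TYPE threefold `X₀/ℚ`
(smooth projective of dimension `3`, `dim H³((X₀)_ℂ) = 2`, a non-zero `(3,0)`-class) and a smooth projective complex
threefold `Y`, every injective algebraic correspondence `A : H³((X₀)_ℂ) → H³(Y)` has an algebraic left inverse.
[cite: Kleiman1968AlgebraicCycles, Appendix to §2 (Thm. 2A11) and §3] [cite: VoisinHodgeI2002, §6.3.2 Thm. 6.32]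
[cite: Deligne1982HodgeCycles, §1–2] -/
theorem algebraicLeftInverse :
    ∀ ⦃X₀ : SchemeOver.{0} ℚ⦄,
      (IsSmoothProjective 3 X₀ ∧ Module.finrank ℂ (complexBetti ((baseChange ℚ ℂ).obj X₀) 3) = 2 ∧
        ∃ x : complexBetti ((baseChange ℚ ℂ).obj X₀) 3, x ≠ 0 ∧
          IsOfHodgeType 3 ((baseChange ℚ ℂ).obj X₀) 3 3 0 x) →
      ∀ ⦃Y : SchemeOver.{0} ℂ⦄, IsSmoothProjective 3 Y →
        ∀ (A : complexBetti ((baseChange ℚ ℂ).obj X₀) 3 →ₗ[ℂ] complexBetti Y 3),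
          IsAlgebraicCorrespondence 3 3 Y ((baseChange ℚ ℂ).obj X₀) A → Function.Injective A →
            ∃ B : complexBetti Y 3 →ₗ[ℂ] complexBetti ((baseChange ℚ ℂ).obj X₀) 3,
              IsAlgebraicCorrespondence 3 3 ((baseChange ℚ ℂ).obj X₀) Y B ∧ B ∘ₗ A = LinearMap.id :=
  fun _ hR _ hY _ hA hinj ↦
    exists_algebraicLeftInverse_of_finrank_eq_two (IsSmoothProjective.baseChange_holds (k := ℚ) ℂ hR.1) hY
      (by norm_num) hR.2.1 hR.2.2 hA hinj

end Summit.HodgeConjecture.HodgeConjecture.Theorems.RelativesTate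

end
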